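import Summits.QuantumFields.YangMills.Theorems.BalabanUVNodesN18HLayerW1TermDatum
import Summits.QuantumFields.BalabanUV.T4Continuum.Spine.NE5.TwoRunTorusPrimitiveParam
import Literature.Analysis.Complex.HolomorphicBanach

/-!
# BalabanUVNodes ∕ N18 — (T-an) DISCHARGED AT node00-def-W1's (2.14) TERM DATUM: the term functional `𝔇.TF` is ANALYTIC IN THE CONFIGURATION on
# every open configuration table, from the located PRIMITIVE inputs read along the configuration (Track A, DAG node N18 = NE5 `T4OutputRate.NE5 EA EB W κ θ C₅`
# :211; cluster K4 «SpineRates»; file 26 of seat pub-ymgap-dag-n18-c, row s1 «the H-layer activity datum on the record's torus catalogue», generation 6)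

Cell `pub-ymgap`, HUMAN RULING D-0062 (Track A), R134 ACCELERATION seat `pub-ymgap-dag-n18-c` (strategy s1 = first missing estimate), generation 6.
THEOREMS ONLY (no `def`, no `instance`, no `sorry`); imports file 25 `…N18HLayerW1TermDatum` (through it files 23 ∕ 24 and W1's STOREY 7
`Node00/HistoryTermDatum214`), the cell `pub-balaban-gaps` engine `Spine/NE5/TwoRunTorusPrimitiveParam` (holomorphy of the (2.14) term in ANY complex
parameter of its primitive objects) and `Literature/Analysis/Complex/HolomorphicBanach` ([Chae1985] Thm 14.13: Fréchet-holomorphic ⇒ analytic on ANY complex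
normed space); restates nothing.

WHY.  After file 25, N18's configuration-direction obligation for W1's generator of record `𝔇.Gn = GenTower.ofTerms L 𝔇.TF` read BY NAME: the located
(2.26) inputs along the history (discharging (T-226)) AND ONE analytic binder `hTan` = (T-an) «the (2.14) term is an analytic function of the configuration
`φ = (𝐔, 𝐉)` on the table» — print: [II] p. 15 «by inspection of (2.14)», no printed derivation.  THIS FILE turns the inspection into a kernel theorem.
By `rfl` (`TermDatum214.TF_apply`) the term is `term214 r (Z∖Z′₀) 𝐃 (core214 (A φ) (Γ φ) (F214 |P| χ χᶜ 𝐃 (𝐕 φ))) 0 0` with the precision `A φ σ` and the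
kernel `G φ σ` of `Γ_k(Z₀,σ)` READ AT THE CONFIGURATION `u = uOf Z t φ`, the potentials `𝐕 φ` of (1.41), and `χ_{k,Y₀}(g,·)`, `χᶜ_{k,P}(g,·)`, `𝐃`, the real
references `C`, `Γ₀`, the locations COMMON along `φ` — the located typing point (x9) of the engine `hol_and_h226_torus_of_primitives_param` («only `A`, `G`,
`𝐕` move with the parameter»), true at the datum BY CONSTRUCTION (the coupling `g` is fixed; the cut (2.3) sits on the Gaussian variable `B`).  The engine
is generic in the complex normed parameter space: at `B := CPair P 𝔸`, `b := φ`, it gives `φ ↦ 𝔇.TF Z t g old φ` `DifferentiableOn ℂ` on any OPEN table `V`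
— holomorphy under the `X`-integral (`B13Core214Holomorphic.differentiableOn_core214X`) at the `2^{|Z∖Z′₀|+|𝐃|}` CORNER VALUES, (2.14) being their signed
double difference on `V` (`B13CauchyDecayPoly.term214_eq_DopC_polyτ`) — together with (2.26) on `V`; Chae's theorem (Mathlib has `DifferentiableOn →
AnalyticOnNhd` only on the domain `ℂ`) upgrades it to `AnalyticOnNhd` on the open table — file 23's (T-an) binder VERBATIM.  So BOTH per-term schemas of
file 23 follow from ONE list of located primitive inputs; N18's side of the (2.14) datum keeps NO analytic binder of its own (the chain: file 27).

WHAT (theorems only).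
* §1 ONE TERM `(Z, t)` of a datum `𝔇 : W1.TermDatum214 c P 𝔸 M k L` at `(g, old)`, ANY `Params`, ANY open `V ⊆ CPair P 𝔸`:
  `differentiableOn_and_norm_TF_of_primitives_param` ((hol in `φ` on `V`) ∧ ((2.26) on `V`); ONE application of the engine), ★ `analyticOnNhd_TF_of_primitives_param`
  (Chae), `analyticOnNhd_TF_of_primitives_param_of_subset` (any `S ⊆ V`).  Binders = the engine's at the datum =
  node00-def-W1's STOREY 8 §2 list (H7-holo at print's PER-DOMAIN τ-radii, `hΨσ ∕ hΨτ`-FREE) quantified `∀ φ ∈ V`, PLUS the three holomorphy-in-`φ` binders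
  `hAholφ`, `hGholφ` (each `σ` of the open σ-polydisc, each entry) and `hVholφ` (each `Y`, `B`).
* §2 A DATUM FAMILY `𝔇 : W1.TermData214 c (F.P K) 𝔸 M L` ALONG THE HISTORY on OPEN located-inputs tables `big (k+1) Z` (section variables quantified
  `∀ k, ∀ g ∈ D, ∀ old` — the `𝐕`-letters under the guard «old ∈ (1.18)`(E₀,r₁)` on `sp` + analytic there» = LEMMA 2's hypothesis — `∀ Z, ∀ φ ∈ big (k+1) Z,
  ∀ t ∈ terms L M Z`): `holAnd226_TF_of_primitives_param`, ★★ `termwiseAn_TF_of_primitives_param` — file 23's `hTan` binder type VERBATIM on every `sp₁ ⊆ big`,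
  PROVED (file 23's `hT226` binder on `big` = the `.2` half of `holAnd226_TF_of_primitives_param`; not restated: its conclusion is file 25 §1's).

HONEST FRAMING — what this is NOT.  ONE application of a landed generic theorem per term + Chae's theorem + bookkeeping along the history; NO estimate
of Bałaban's is proved here.  DISPLAYED, not discharged (other lanes, by name): NODE A's kernel records at the configuration — holomorphy of
`A(σ, uOf φ)`, `G(σ, uOf φ)` in `σ` on the open σ-polydisc and in `φ` on the table (the records' joint `(σ,u)`-analyticity `JointWalkExpansion.AnalyticOnBall`
∘ the reading map `uOf`, cf. `B13Term214JetAgreement.differentiableOn_core214_cfg`), (L17a)∕(L16a) on the open σ-polydisc, symmetry ∕ `Re ≻ 0`; LEMMA 2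
([II] (1.41) p. 11, (2.20) p. 16): the potentials holomorphic in `φ`, measurable in `B`, with (2.20) on the τ-regions, along the history under the (1.18)
guard; [II] (2.22); measurability of `χ`, `χᶜ`; the numerics.  The datum itself is DATA (node00-def-B13's reading of the kernels of record is the later
programme).  Count-neutral; NOT a discharge of N18 (typed 28∕28 · discharged 5∕27 UNCHANGED); NE5 NOT IN PRINT ([I] Thm 1 p. 259) and NOT PROVED.  One
finite four-torus programme at fixed `ε`, Bałaban as printed — NOT ℝ⁴, NOT infinite volume, NOT OS, NOT a mass gap, NOT Clay.  0 `sorry`, 0 `def`.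

References (TYPES ∕ loci only): [II] = [Balaban1988RG2Cluster] CMP **116** (1988) — (1.41) p. 11, (2.3) p. 12, (2.14) p. 15 and the analyticity
statement p. 15, (2.16)–(2.22) p. 16, (2.23)–(2.26) p. 17; [I] = [Balaban1987RG1] CMP **109** (1987) — (1.18) p. 263, Thm 1 p. 259; [Chae1985] S. B. Chae,
*Holomorphy and Calculus in Normed Spaces* (1985), Thm 14.13.
-/

noncomputable section

open scoped Classical

namespace Summit.QuantumFields.YangMills.BalabanUVNodes.N18HLayerW1TermAnalytic

open Set Metric
open scoped BigOperators Matrix Matrix.Norms.L2Operator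
open Literature.MathematicalPhysics.QuantumFieldTheory.Balaban1983to89
open Literature.MathematicalPhysics.QuantumFieldTheory.Balaban1983to89.T4Continuum (T4Family)
open Literature.MathematicalPhysics.QuantumFieldTheory.Balaban1983to89.TreeLengthTorus (TDom TPt tsys)
open Literature.MathematicalPhysics.QuantumFieldTheory.Balaban1983to89.B13Lemma3TorusTerms (terms weight)
open Literature.MathematicalPhysics.QuantumFieldTheory.Balaban1983to89.B13Bound143 (invTau)
open Literature.MathematicalPhysics.QuantumFieldTheory.Balaban1983to89.B9Thm37GlueTorus (tdist1)
open Literature.MathematicalPhysics.QuantumFieldTheory.Balaban1983to89.B5TorusCover (UT)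
open Literature.MathematicalPhysics.QuantumFieldTheory.Balaban1983to89.Node00
open Literature.MathematicalPhysics.QuantumFieldTheory.Balaban1983to89.Node00.Sect2 (domSys domCount CPair)
open Literature.MathematicalPhysics.QuantumFieldTheory.Balaban1983to89.Node00.W1
open Literature.Analysis.Complex.HolomorphicBanach (analyticOnNhd_of_differentiableOn)
open Summit.QuantumFields.BalabanUV.T4Continuum.Spine.NE5.TwoRunTorusPrimitiveParam (hol_and_h226_torus_of_primitives_param)

/-! ## §1 One term of a datum: holomorphy in the configuration on an open table + (2.26) there, from the located primitive inputs -/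

section OneTerm

variable {c : B13.Consts} {P : Params} {𝔸 : Type} [NormedRing 𝔸] [NormedAlgebra ℂ 𝔸] {M k L : ℕ} [NeZero L]
  (𝔇 : TermDatum214 c P 𝔸 M k L)

variable (hκ₁ : 1 ≤ c.κ₁) (hα₆ : c.α₆ ≠ 0)
    (Z : (domSys P M (k + 1)).Dom) (t : TermLabel P M k L) (s : ℂ) (old : OlderTerms P 𝔸 M k)
    {V : Set (CPair P 𝔸)} (hV : IsOpen V)
    (hpos : ∀ Y : TDom P.d (L * domCount P M (k + 1)), 0 < invTau c ((tsys P.d (L * domCount P M (k + 1))).dj Y))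
    (hhalf : ∀ Y : TDom P.d (L * domCount P M (k + 1)), invTau c ((tsys P.d (L * domCount P M (k + 1))).dj Y) ≤ 1 / 2)
    -- the σ-region (one open set ⊇ the closed e^{κ₁}-ball) and the PER-DOMAIN τ-regions (print's radii (2.18)); the contour radius of the datum
    {Uσ : Set ℂ} {Uτ : TDom P.d (L * domCount P M (k + 1)) → Set ℂ} (hUσ : IsOpen Uσ) (hUτ : ∀ Y, IsOpen (Uτ Y))
    (hUexp : closedBall (0 : ℂ) (Real.exp c.κ₁) ⊆ Uσ)
    (hUtau : ∀ Y : TDom P.d (L * domCount P M (k + 1)),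
      closedBall (0 : ℂ) ((invTau c ((tsys P.d (L * domCount P M (k + 1))).dj Y))⁻¹) ⊆ Uτ Y)
    (hr : 0 < 𝔇.r) (hr' : 𝔇.r ≤ Real.exp c.κ₁ - 1)
    (hsubτ : ∀ Y, ∀ x ∈ Set.uIcc (0 : ℝ) 1, closedBall (x : ℂ) 𝔇.r ⊆ Uτ Y)
    -- the last line at the coupling: signs and measurability of χ, χᶜ
    (hχ0 : ∀ B, 0 ≤ 𝔇.chiY₀ Z t s B) (hχc0 : ∀ B, 0 ≤ 𝔇.chicP Z t s B)
    (hχm : Measurable (𝔇.chiY₀ Z t s)) (hχcm : Measurable (𝔇.chicP Z t s))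
    -- NODE A at the configuration: entrywise holomorphy of the kernels IN σ on the open σ-polydisc (each φ of the table) and IN φ on the table (each σ)
    (hAhol : ∀ φ ∈ V, ∀ i j, DifferentiableOn ℂ (fun σ => 𝔇.A Z t φ σ i j) {σ | ∀ j, σ j ∈ Uσ})
    (hGhol : ∀ φ ∈ V, ∀ i j, DifferentiableOn ℂ (fun σ => (𝔇.𝒦 Z t).G2 σ (𝔇.uOf Z t φ) i j) {σ | ∀ j, σ j ∈ Uσ})
    (hAholφ : ∀ σ : TPt P.d (domCount P M (k + 1)) → ℂ, (∀ j, σ j ∈ Uσ) → ∀ i j, DifferentiableOn ℂ (fun φ => 𝔇.A Z t φ σ i j) V)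
    (hGholφ : ∀ σ : TPt P.d (domCount P M (k + 1)) → ℂ, (∀ j, σ j ∈ Uσ) →
      ∀ i j, DifferentiableOn ℂ (fun φ => (𝔇.𝒦 Z t).G2 σ (𝔇.uOf Z t φ) i j) V)
    -- LEMMA 2 at (coupling, history): the potentials holomorphic IN φ on the table, measurable in the row-bond field
    (hVholφ : ∀ Y B, DifferentiableOn ℂ (fun φ => 𝔇.𝒱 Z t s old φ Y B) V)
    (hVm : ∀ φ ∈ V, ∀ Y, Measurable (𝔇.𝒱 Z t s old φ Y))
    -- NODE A: symmetry and `Re ≻ 0` of the precision at (σ, u), on the open σ-polydisc, along the table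
    (hAs : ∀ φ ∈ V, ∀ σ : TPt P.d (domCount P M (k + 1)) → ℂ, (∀ j, σ j ∈ Uσ) → (𝔇.A Z t φ σ).IsSymm)
    (hA : ∀ φ ∈ V, ∀ σ : TPt P.d (domCount P M (k + 1)) → ℂ, (∀ j, σ j ∈ Uσ) → ((𝔇.A Z t φ σ).map Complex.re).PosDef)
    -- the (2.22) shape at the coupling, and (2.20) on the open PER-DOMAIN τ-region, uniform on the table
    {γ₂ rP a₂₀ w : ℝ} (qP : ((𝔇.𝒦 Z t).Λ → ℝ) → ℝ)
    (h222 : ∀ B, 𝔇.chiY₀ Z t s B * 𝔇.chicP Z t s B ≤ Real.exp (-(γ₂ / 2 * rP ^ 2 * (t.2.card : ℕ)) + γ₂ / 2 * qP B)) (hγ₂ : 0 ≤ γ₂)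
    (hqP : ∀ B, qP B ≤ B ⬝ᵥ B) (ha0 : 0 ≤ a₂₀)
    (h220U : ∀ φ ∈ V, ∀ τ : TDom P.d (L * domCount P M (k + 1)) → ℂ, (∀ Y, τ Y ∈ Uτ Y) →
      ∀ B, ∑ Y ∈ t.1, ‖τ Y‖ * ‖𝔇.𝒱 Z t s old φ Y B‖ ≤ a₂₀ / 2 * (B ⬝ᵥ B) + w)
    -- the column fibre bound (rows: the kernel record's `hfib`)
    (hfibN : ∀ x : UT 𝔇.Nf, (Finset.univ.filter fun j => (𝔇.𝒦 Z t).locN j = x).card ≤ (𝔇.𝒦 Z t).m)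
    -- rates and constants
    {kap kap' kap'' θ θE θΓ θC KG KΓ KCs KC : ℝ} (hkap'' : 0 < kap'') (h1 : kap'' < kap') (h2 : kap' < kap)
    (hθE : 0 ≤ θE) (hθΓ : 0 ≤ θΓ) (hθC : 0 ≤ θC) (hKG : 0 ≤ KG) (hKΓ : 0 ≤ KΓ) (hKCs : 0 ≤ KCs) (hKC : 0 ≤ KC)
    (hθEle : θE ≤ θ) (hθΓle : θΓ ≤ θ)
    (hθR1le : ((𝔇.𝒦 Z t).m * (1 + 2 / (kap - kap')) ^ 𝔇.ν) * ((𝔇.𝒦 Z t).m * (1 + 2 / (kap' - kap'')) ^ 𝔇.ν)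
      * (θΓ * KCs * KG + KΓ * θC * KG + KΓ * KC * θΓ) ≤ θ)
    -- (L17a) for the kernels at the configuration, in the torus distance, uniform on the table and the open σ-polydisc
    (hG : ∀ φ ∈ V, ∀ σ : TPt P.d (domCount P M (k + 1)) → ℂ, (∀ j, σ j ∈ Uσ) →
      ∀ b j, ‖(𝔇.𝒦 Z t).G2 σ (𝔇.uOf Z t φ) b j‖ ≤ KG * Real.exp (-(kap * tdist1 𝔇.Nf ((𝔇.𝒦 Z t).locΛ b) ((𝔇.𝒦 Z t).locN j))))
    (hΓ₀ : ∀ b j, ‖(𝔇.𝒦 Z t).Γ₀ b j‖ ≤ KΓ * Real.exp (-(kap * tdist1 𝔇.Nf ((𝔇.𝒦 Z t).locΛ b) ((𝔇.𝒦 Z t).locN j))))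
    (hCs : ∀ φ ∈ V, ∀ σ : TPt P.d (domCount P M (k + 1)) → ℂ, (∀ j, σ j ∈ Uσ) →
      ∀ b b', ‖(𝔇.A Z t φ σ)⁻¹ b b'‖ ≤ KCs * Real.exp (-(kap * tdist1 𝔇.Nf ((𝔇.𝒦 Z t).locΛ b) ((𝔇.𝒦 Z t).locΛ b'))))
    (hC216 : ∀ b b', ‖(𝔇.𝒦 Z t).C b b'‖ ≤ KC * Real.exp (-(kap * tdist1 𝔇.Nf ((𝔇.𝒦 Z t).locΛ b) ((𝔇.𝒦 Z t).locΛ b'))))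
    -- (L16a) for the kernels at the configuration, in the torus distance, uniform on the table and the open σ-polydisc
    (hdΓ : ∀ φ ∈ V, ∀ σ : TPt P.d (domCount P M (k + 1)) → ℂ, (∀ j, σ j ∈ Uσ) →
      ∀ b j, ‖((𝔇.𝒦 Z t).G2 σ (𝔇.uOf Z t φ) - (𝔇.𝒦 Z t).Γ₀.map (algebraMap ℝ ℂ)) b j‖
        ≤ θΓ * Real.exp (-(kap * tdist1 𝔇.Nf ((𝔇.𝒦 Z t).locΛ b) ((𝔇.𝒦 Z t).locN j))))
    (hdC : ∀ φ ∈ V, ∀ σ : TPt P.d (domCount P M (k + 1)) → ℂ, (∀ j, σ j ∈ Uσ) →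
      ∀ b b', ‖((𝔇.A Z t φ σ)⁻¹ - (𝔇.𝒦 Z t).C.map (algebraMap ℝ ℂ)) b b'‖
        ≤ θC * Real.exp (-(kap * tdist1 𝔇.Nf ((𝔇.𝒦 Z t).locΛ b) ((𝔇.𝒦 Z t).locΛ b'))))
    (hdE : ∀ φ ∈ V, ∀ σ : TPt P.d (domCount P M (k + 1)) → ℂ, (∀ j, σ j ∈ Uσ) →
      ∀ b b', ‖(𝔇.A Z t φ σ - (𝔇.𝒦 Z t).C⁻¹.map (algebraMap ℝ ℂ)) b b'‖
        ≤ θE * Real.exp (-(kap * tdist1 𝔇.Nf ((𝔇.𝒦 Z t).locΛ b) ((𝔇.𝒦 Z t).locΛ b'))))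
    (hsmallKθ : KC * ((𝔇.𝒦 Z t).m * (1 + 2 / kap) ^ 𝔇.ν) * (θ * ((𝔇.𝒦 Z t).m * (1 + 2 / kap'') ^ 𝔇.ν)) < 1)
    -- the (2.24)–(2.25) smallness
    {cE g : ℝ} (hc0 : 0 ≤ cE) (hc : ∀ i, (𝔇.𝒦 Z t).hC.1.eigenvalues i ≤ cE)
    (hαc : (2 * (θ * ((𝔇.𝒦 Z t).m * (1 + 2 / kap'') ^ 𝔇.ν)) + (γ₂ + a₂₀)) * cE ≤ 1 / 2) (hg : 0 ≤ g)
    (hΓq : ∀ X : (𝔇.𝒦 Z t).Λ ⊕ (𝔇.𝒦 Z t).C₀ → ℝ,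
      ((𝔇.𝒦 Z t).Γ₀ *ᵥ X) ⬝ᵥ ((𝔇.𝒦 Z t).C *ᵥ ((𝔇.𝒦 Z t).Γ₀ *ᵥ X)) ≤ g * (X ⬝ᵥ X))
    (hsmall : (2 * (θ * ((𝔇.𝒦 Z t).m * (1 + 2 / kap'') ^ 𝔇.ν)) + (γ₂ + a₂₀)) * (1 + 2 * cE * g) ≤ 1 / 2)
    -- constant matching, p. 17
    {a a₅ : ℝ} (hPa : a ≤ γ₂ * rP ^ 2)
    (hvol : 2 * (KC * ((𝔇.𝒦 Z t).m * (1 + 2 / kap) ^ 𝔇.ν) * (θ * ((𝔇.𝒦 Z t).m * (1 + 2 / kap'') ^ 𝔇.ν))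
              * (1 + (1 - KC * ((𝔇.𝒦 Z t).m * (1 + 2 / kap) ^ 𝔇.ν) * (θ * ((𝔇.𝒦 Z t).m * (1 + 2 / kap'') ^ 𝔇.ν)))⁻¹) / 2)
          * (Fintype.card (𝔇.𝒦 Z t).Λ : ℝ)
        + w + (2 * (θ * ((𝔇.𝒦 Z t).m * (1 + 2 / kap'') ^ 𝔇.ν)) + (γ₂ + a₂₀)) * cE * (Fintype.card (𝔇.𝒦 Z t).Λ : ℝ)
        + (2 * (θ * ((𝔇.𝒦 Z t).m * (1 + 2 / kap'') ^ 𝔇.ν)) + (γ₂ + a₂₀)) * (1 + 2 * cE * g)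
          * (Fintype.card ((𝔇.𝒦 Z t).Λ ⊕ (𝔇.𝒦 Z t).C₀) : ℝ)
        ≤ a₅ * ((Z.1).card : ℝ))


include hκ₁ hα₆ hV hpos hhalf hUσ hUτ hUexp hUtau hr hr' hsubτ hχ0 hχc0 hχm hχcm hAhol hGhol hAholφ hGholφ hVholφ hVm hAs hA h222 hγ₂ hqP ha0 h220U hfibN hkap'' h1 h2 hθE hθΓ hθC hKG hKΓ hKCs hKC hθEle hθΓle hθR1le hG hΓ₀ hCs hC216 hdΓ hdC hdE hsmallKθ hc0 hc hαc hg hΓq hsmall hPa hvol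

/-- **(T-an) ∧ (T-226) FOR ONE TERM OF THE DATUM ON AN OPEN CONFIGURATION TABLE, FROM THE LOCATED PRIMITIVE INPUTS ALONG THE CONFIGURATION** —
`TwoRunTorusPrimitiveParam.hol_and_h226_torus_of_primitives_param` at the parameter space `B := CPair P 𝔸`, `b := φ`, for the term
`𝔇.TF Z t g old φ = term214 r (Z∖Z′₀) 𝐃 (core214 (A φ) (Γ φ) (F214 |P| χ χᶜ 𝐃 (𝐕 φ))) 0 0` (`TF_apply`, `rfl`) with `A φ σ := (𝒦 Z t).A2 σ (uOf φ)`,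
`G φ σ := (𝒦 Z t).G2 σ (uOf φ)`, `Γ := 𝔇.Gam` (linear, `rfl`), `𝐕 φ := 𝒱 Z t g old φ`, the references `C`, `Γ₀`, the locations and the row fibre bound read
off NODE A's kernel record, `χ_{k,Y₀}(g,·)`, `χᶜ_{k,P}(g,·)`, `𝐃` common along `φ`.  Hypotheses, UNIFORM on the open table `V`: the τ-radii conditions of
(2.18), the σ-region `Uσ ⊇ {|σ| ≤ e^{κ₁}}` and the PER-DOMAIN τ-regions, the contour radius; signs and measurability of `χ`, `χᶜ` and the (2.22) shape;
entrywise holomorphy of `A(σ, uOf φ)`, `G(σ, uOf φ)` IN `σ` on the open σ-polydisc (each `φ ∈ V`) and IN `φ` on `V` (each `σ` of the polydisc); the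
potentials holomorphic IN `φ` on `V`, measurable in `B`, with (2.20) on the τ-regions; symmetry ∕ `Re ≻ 0` of the precision; (L17a) ∕ (L16a) for the kernels at
the configuration; the numerics of (2.24)–(2.26).  Conclusion: `φ ↦ 𝔇.TF Z t g old φ` is `DifferentiableOn ℂ` on `V` AND (2.26) holds at every `φ ∈ V`.
[cite: Balaban1988RG2Cluster, (2.14)-(2.15) p.15 and the analyticity statement p.15, (2.16)-(2.22) p.16, (2.23)-(2.26) p.17] -/
theorem differentiableOn_and_norm_TF_of_primitives_param :
    DifferentiableOn ℂ (fun φ => 𝔇.TF Z t s old φ) V ∧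
      ∀ φ ∈ V, ‖𝔇.TF Z t s old φ‖ ≤ weight L M c Z a t * Real.exp (a₅ * ((Z.1).card : ℝ)) :=
  hol_and_h226_torus_of_primitives_param c hκ₁ hα₆ Z t hpos hhalf hUσ hUτ hUexp hUtau hr hr' hsubτ
    (sigmaList L Z t) (sigmaList_spec Z t) (tauList P M k L t) (tauList_spec t) hV
    (fun φ => 𝔇.A Z t φ) (fun φ => 𝔇.Gam Z t φ) (fun φ σ => (𝔇.𝒦 Z t).G2 σ (𝔇.uOf Z t φ))
    (𝔇.chiY₀ Z t s) (𝔇.chicP Z t s) hχ0 hχc0 t.1 (fun φ => 𝔇.𝒱 Z t s old φ) (𝔇.𝒦 Z t).hC (𝔇.𝒦 Z t).Γ₀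
    hAhol hGhol hAholφ hGholφ hVholφ hχm hχcm hVm hAs hA (fun _ _ _ _ _ => rfl)
    qP h222 hγ₂ hqP ha0 h220U (𝔇.𝒦 Z t).locΛ (𝔇.𝒦 Z t).locN (𝔇.𝒦 Z t).hfib hfibN
    hkap'' h1 h2 hθE hθΓ hθC hKG hKΓ hKCs hKC hθEle hθΓle hθR1le hG hΓ₀ hCs hC216 hdΓ hdC hdE hsmallKθ hc0 hc hαc hg hΓq hsmall hPa hvol

/-- **★ (T-an) FOR ONE TERM OF THE DATUM ON AN OPEN CONFIGURATION TABLE** — print's «analytic function of (𝐔, 𝐉) … by inspection of (2.14)» as a theorem: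
under §1's located primitive inputs `φ ↦ 𝔇.TF Z t g old φ` is ANALYTIC at every point of the open table `V` ([Chae1985] Thm 14.13 on the complex normed
space `CPair P 𝔸`: Fréchet-holomorphic on an open set ⇒ analytic; `HolomorphicBanach.analyticOnNhd_of_differentiableOn`).
[cite: Balaban1988RG2Cluster, (2.14) p.15 and the analyticity statement p.15; Chae1985, Thm 14.13] -/
theorem analyticOnNhd_TF_of_primitives_param : AnalyticOnNhd ℂ (fun φ => 𝔇.TF Z t s old φ) V :=
  analyticOnNhd_of_differentiableOn
    (differentiableOn_and_norm_TF_of_primitives_param 𝔇 hκ₁ hα₆ Z t s old hV hpos hhalf hUσ hUτ hUexp hUtau hr hr' hsubτ hχ0 hχc0 hχm hχcm hAhol hGhol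
      hAholφ hGholφ hVholφ hVm hAs hA qP h222 hγ₂ hqP ha0 h220U hfibN hkap'' h1 h2 hθE hθΓ hθC hKG hKΓ hKCs hKC hθEle hθΓle hθR1le hG hΓ₀ hCs
      hC216 hdΓ hdC hdE hsmallKθ hc0 hc hαc hg hΓq hsmall hPa hvol).1 hV

/-- **(T-an) ON ANY TABLE INSIDE THE OPEN LOCATED-INPUTS TABLE** (file 23's binder shape: the step's table `sp (k+1) Z ⊆ V`).
[cite: Balaban1988RG2Cluster, (2.14) p.15 and the analyticity statement p.15; Chae1985, Thm 14.13] -/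
theorem analyticOnNhd_TF_of_primitives_param_of_subset {S : Set (CPair P 𝔸)} (hS : S ⊆ V) :
    AnalyticOnNhd ℂ (fun φ => 𝔇.TF Z t s old φ) S :=
  (analyticOnNhd_TF_of_primitives_param 𝔇 hκ₁ hα₆ Z t s old hV hpos hhalf hUσ hUτ hUexp hUtau hr hr' hsubτ hχ0 hχc0 hχm hχcm hAhol hGhol
      hAholφ hGholφ hVholφ hVm hAs hA qP h222 hγ₂ hqP ha0 h220U hfibN hkap'' h1 h2 hθE hθΓ hθC hKG hKΓ hKCs hKC hθEle hθΓle hθR1le hG hΓ₀ hCs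
      hC216 hdΓ hdC hdE hsmallKθ hc0 hc hαc hg hΓq hsmall hPa hvol).mono hS

end OneTerm

/-! ## §2 A datum family along the history: (T-an) and (T-226) on the open located-inputs tables, from the located primitive inputs -/

section Located

variable (F : T4Family) (K : ℕ) {𝔸 : Type} [NormedRing 𝔸] [NormedAlgebra ℂ 𝔸] {M : ℕ} [NeZero M] (L : ℕ) [NeZero L]
  {c : B13.Consts} (𝔇 : TermData214 c (F.P K) 𝔸 M L) (D : Set ℂ)
  (sp big : (j : ℕ) → (domSys (F.P K) M j).Dom → Set (CPair (F.P K) 𝔸)) {E₀ r₁ : ℝ}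
  -- the located-inputs tables are OPEN (print's analyticity SPACE (1.15)–(1.17) with the larger radii, [II] p. 15)
  (hbigo : ∀ (k : ℕ) (Z : (domSys (F.P K) M (k + 1)).Dom), IsOpen (big (k + 1) Z))
  -- the `B13.Consts` letters the (2.26) engine divides by
  (hκ₁ : 1 ≤ c.κ₁) (hα₆ : c.α₆ ≠ 0)
  -- (2.18): the τ-radii `|τ(Y)| = (invTau c (d_k Y))⁻¹ ≥ 2` on every fine torus of the catalogue
  (hpos : ∀ k : ℕ, ∀ Y : TDom (F.P K).d (L * domCount (F.P K) M (k + 1)),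
    0 < invTau c ((tsys (F.P K).d (L * domCount (F.P K) M (k + 1))).dj Y))
  (hhalf : ∀ k : ℕ, ∀ Y : TDom (F.P K).d (L * domCount (F.P K) M (k + 1)),
    invTau c ((tsys (F.P K).d (L * domCount (F.P K) M (k + 1))).dj Y) ≤ 1 / 2)
  -- the Cauchy data: ONE open σ-region ⊇ the closed e^{κ₁}-polydisc, PER-DOMAIN open τ-regions at every level, the contour radii of the data
  {Uσ : Set ℂ} {Uτ : (k : ℕ) → TDom (F.P K).d (L * domCount (F.P K) M (k + 1)) → Set ℂ} (hUσ : IsOpen Uσ) (hUτ : ∀ k Y, IsOpen (Uτ k Y))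
  (hUexp : closedBall (0 : ℂ) (Real.exp c.κ₁) ⊆ Uσ)
  (hUtau : ∀ k : ℕ, ∀ Y : TDom (F.P K).d (L * domCount (F.P K) M (k + 1)),
    closedBall (0 : ℂ) ((invTau c ((tsys (F.P K).d (L * domCount (F.P K) M (k + 1))).dj Y))⁻¹) ⊆ Uτ k Y)
  (hr : ∀ k : ℕ, 0 < (𝔇 k).r) (hr' : ∀ k : ℕ, (𝔇 k).r ≤ Real.exp c.κ₁ - 1)
  (hsubτ : ∀ k : ℕ, ∀ Y, ∀ x ∈ Set.uIcc (0 : ℝ) 1, closedBall (x : ℂ) (𝔇 k).r ⊆ Uτ k Y)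
  -- (2.3) at the couplings of `D`: signs and measurability of `χ`, `χᶜ`
  (hχ0 : ∀ (k : ℕ) (Z : (domSys (F.P K) M (k + 1)).Dom) (t : TermLabel (F.P K) M k L), ∀ s ∈ D, ∀ B, 0 ≤ (𝔇 k).chiY₀ Z t s B)
  (hχc0 : ∀ (k : ℕ) (Z : (domSys (F.P K) M (k + 1)).Dom) (t : TermLabel (F.P K) M k L), ∀ s ∈ D, ∀ B, 0 ≤ (𝔇 k).chicP Z t s B)
  (hχm : ∀ (k : ℕ) (Z : (domSys (F.P K) M (k + 1)).Dom) (t : TermLabel (F.P K) M k L), ∀ s ∈ D, Measurable ((𝔇 k).chiY₀ Z t s))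
  (hχcm : ∀ (k : ℕ) (Z : (domSys (F.P K) M (k + 1)).Dom) (t : TermLabel (F.P K) M k L), ∀ s ∈ D, Measurable ((𝔇 k).chicP Z t s))
  -- NODE A AT THE CONFIGURATION: the kernels `A(σ, uOf φ)`, `G(σ, uOf φ)` entrywise holomorphic IN σ on the open σ-polydisc (each φ of the table) and
  -- IN φ on the open table (each σ of the polydisc) — the records' joint (σ,u)-analyticity ∘ the reading map
  (hAhol : ∀ (k : ℕ) (Z : (domSys (F.P K) M (k + 1)).Dom), ∀ φ ∈ big (k + 1) Z, ∀ t ∈ terms L M Z,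
    ∀ i j, DifferentiableOn ℂ (fun σ => (𝔇 k).A Z t φ σ i j) {σ | ∀ j, σ j ∈ Uσ})
  (hGhol : ∀ (k : ℕ) (Z : (domSys (F.P K) M (k + 1)).Dom), ∀ φ ∈ big (k + 1) Z, ∀ t ∈ terms L M Z,
    ∀ i j, DifferentiableOn ℂ (fun σ => ((𝔇 k).𝒦 Z t).G2 σ ((𝔇 k).uOf Z t φ) i j) {σ | ∀ j, σ j ∈ Uσ})
  (hAholφ : ∀ (k : ℕ) (Z : (domSys (F.P K) M (k + 1)).Dom), ∀ t ∈ terms L M Z, ∀ σ : TPt (F.P K).d (domCount (F.P K) M (k + 1)) → ℂ,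
    (∀ j, σ j ∈ Uσ) → ∀ i j, DifferentiableOn ℂ (fun φ => (𝔇 k).A Z t φ σ i j) (big (k + 1) Z))
  (hGholφ : ∀ (k : ℕ) (Z : (domSys (F.P K) M (k + 1)).Dom), ∀ t ∈ terms L M Z, ∀ σ : TPt (F.P K).d (domCount (F.P K) M (k + 1)) → ℂ,
    (∀ j, σ j ∈ Uσ) → ∀ i j, DifferentiableOn ℂ (fun φ => ((𝔇 k).𝒦 Z t).G2 σ ((𝔇 k).uOf Z t φ) i j) (big (k + 1) Z))
  -- LEMMA 2 ALONG THE HISTORY ([II] (1.41), p. 15): under «old ∈ (1.18)`(E₀,r₁)` on the tables + analytic there» the potentials `𝐕_k(Y, g, old, φ, ·)` are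
  -- holomorphic IN φ on the open table and measurable in the row-bond field, with the (2.20) shape on the open PER-DOMAIN τ-region
  (hVholφ : ∀ k : ℕ, ∀ s ∈ D, ∀ old : OlderTerms (F.P K) 𝔸 M k,
    (∀ (j : Fin (k + 1)) (Y : (domSys (F.P K) M j).Dom), ∀ ψ ∈ sp j Y,
        ‖old j Y ψ‖ ≤ E₀ * Real.exp (-(r₁ * (domSys (F.P K) M j).dj Y))) →
    (∀ (j : Fin (k + 1)) (Y : (domSys (F.P K) M j).Dom), AnalyticOnNhd ℂ (old j Y) (sp j Y)) →
    ∀ (Z : (domSys (F.P K) M (k + 1)).Dom), ∀ t ∈ terms L M Z,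
      ∀ Y B, DifferentiableOn ℂ (fun φ => (𝔇 k).𝒱 Z t s old φ Y B) (big (k + 1) Z))
  (hVm : ∀ k : ℕ, ∀ s ∈ D, ∀ old : OlderTerms (F.P K) 𝔸 M k,
    (∀ (j : Fin (k + 1)) (Y : (domSys (F.P K) M j).Dom), ∀ ψ ∈ sp j Y,
        ‖old j Y ψ‖ ≤ E₀ * Real.exp (-(r₁ * (domSys (F.P K) M j).dj Y))) →
    (∀ (j : Fin (k + 1)) (Y : (domSys (F.P K) M j).Dom), AnalyticOnNhd ℂ (old j Y) (sp j Y)) →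
    ∀ (Z : (domSys (F.P K) M (k + 1)).Dom), ∀ φ ∈ big (k + 1) Z, ∀ t ∈ terms L M Z, ∀ Y, Measurable ((𝔇 k).𝒱 Z t s old φ Y))
  -- NODE A ([II] p. 15): symmetry and `Re ≻ 0` of the precision `A(σ, u(φ))` on the open σ-polydisc, at the configurations of the table
  (hAs : ∀ (k : ℕ) (Z : (domSys (F.P K) M (k + 1)).Dom), ∀ φ ∈ big (k + 1) Z, ∀ t ∈ terms L M Z,
    ∀ σ : TPt (F.P K).d (domCount (F.P K) M (k + 1)) → ℂ, (∀ j, σ j ∈ Uσ) → ((𝔇 k).A Z t φ σ).IsSymm)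
  (hA : ∀ (k : ℕ) (Z : (domSys (F.P K) M (k + 1)).Dom), ∀ φ ∈ big (k + 1) Z, ∀ t ∈ terms L M Z,
    ∀ σ : TPt (F.P K).d (domCount (F.P K) M (k + 1)) → ℂ, (∀ j, σ j ∈ Uσ) → (((𝔇 k).A Z t φ σ).map Complex.re).PosDef)
  -- [II] (2.22) for `χχᶜ` at the couplings of `D` (quadratic forms `qP ≤ B·B`) and LEMMA 2's (2.20) on the open per-domain τ-region ALONG THE HISTORY
  {γ₂ rP a₂₀ w : ℝ} (hγ₂ : 0 ≤ γ₂) (ha0 : 0 ≤ a₂₀)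
  (qP : (k : ℕ) → (Z : (domSys (F.P K) M (k + 1)).Dom) → (t : TermLabel (F.P K) M k L) → (((𝔇 k).𝒦 Z t).Λ → ℝ) → ℝ)
  (hqP : ∀ (k : ℕ) (Z : (domSys (F.P K) M (k + 1)).Dom) (t : TermLabel (F.P K) M k L) (B : ((𝔇 k).𝒦 Z t).Λ → ℝ), qP k Z t B ≤ B ⬝ᵥ B)
  (h222 : ∀ (k : ℕ) (Z : (domSys (F.P K) M (k + 1)).Dom) (t : TermLabel (F.P K) M k L), ∀ s ∈ D, ∀ B : ((𝔇 k).𝒦 Z t).Λ → ℝ,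
    (𝔇 k).chiY₀ Z t s B * (𝔇 k).chicP Z t s B ≤ Real.exp (-(γ₂ / 2 * rP ^ 2 * (t.2.card : ℕ)) + γ₂ / 2 * qP k Z t B))
  (h220U : ∀ k : ℕ, ∀ s ∈ D, ∀ old : OlderTerms (F.P K) 𝔸 M k,
    (∀ (j : Fin (k + 1)) (Y : (domSys (F.P K) M j).Dom), ∀ ψ ∈ sp j Y,
        ‖old j Y ψ‖ ≤ E₀ * Real.exp (-(r₁ * (domSys (F.P K) M j).dj Y))) →
    (∀ (j : Fin (k + 1)) (Y : (domSys (F.P K) M j).Dom), AnalyticOnNhd ℂ (old j Y) (sp j Y)) →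
    ∀ (Z : (domSys (F.P K) M (k + 1)).Dom), ∀ φ ∈ big (k + 1) Z, ∀ t ∈ terms L M Z,
      ∀ τ : TDom (F.P K).d (L * domCount (F.P K) M (k + 1)) → ℂ, (∀ Y, τ Y ∈ Uτ k Y) →
        ∀ B : ((𝔇 k).𝒦 Z t).Λ → ℝ, ∑ Y ∈ t.1, ‖τ Y‖ * ‖(𝔇 k).𝒱 Z t s old φ Y B‖ ≤ a₂₀ / 2 * (B ⬝ᵥ B) + w)
  -- the column fibre bound of the kernel record's locations
  (hfibN : ∀ (k : ℕ) (Z : (domSys (F.P K) M (k + 1)).Dom) (t : TermLabel (F.P K) M k L) (x : UT (𝔇 k).Nf),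
    (Finset.univ.filter fun j => ((𝔇 k).𝒦 Z t).locN j = x).card ≤ ((𝔇 k).𝒦 Z t).m)
  -- rates and uniform constants
  {kap kap' kap'' θ θE θΓ θC KG KΓ KCs KC : ℝ} (hkap'' : 0 < kap'') (h1 : kap'' < kap') (h2 : kap' < kap)
  (hθE : 0 ≤ θE) (hθΓ : 0 ≤ θΓ) (hθC : 0 ≤ θC) (hKG : 0 ≤ KG) (hKΓ : 0 ≤ KΓ) (hKCs : 0 ≤ KCs) (hKC : 0 ≤ KC)
  (hθEle : θE ≤ θ) (hθΓle : θΓ ≤ θ)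
  (hθR1le : ∀ (k : ℕ) (Z : (domSys (F.P K) M (k + 1)).Dom) (t : TermLabel (F.P K) M k L),
    ((((𝔇 k).𝒦 Z t).m : ℝ) * (1 + 2 / (kap - kap')) ^ (𝔇 k).ν) * ((((𝔇 k).𝒦 Z t).m : ℝ) * (1 + 2 / (kap' - kap'')) ^ (𝔇 k).ν)
      * (θΓ * KCs * KG + KΓ * θC * KG + KΓ * KC * θΓ) ≤ θ)
  -- NODE A AT THE CONFIGURATION: (L17a) and (L16a) for the kernel record read at `u = uOf Z t φ`, on the open σ-polydisc, uniform on the table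
  (hG : ∀ (k : ℕ) (Z : (domSys (F.P K) M (k + 1)).Dom), ∀ φ ∈ big (k + 1) Z, ∀ t ∈ terms L M Z,
    ∀ σ : TPt (F.P K).d (domCount (F.P K) M (k + 1)) → ℂ, (∀ j, σ j ∈ Uσ) → ∀ b j, ‖((𝔇 k).𝒦 Z t).G2 σ ((𝔇 k).uOf Z t φ) b j‖ ≤
      KG * Real.exp (-(kap * tdist1 (𝔇 k).Nf (((𝔇 k).𝒦 Z t).locΛ b) (((𝔇 k).𝒦 Z t).locN j))))
  (hΓ₀ : ∀ (k : ℕ) (Z : (domSys (F.P K) M (k + 1)).Dom) (t : TermLabel (F.P K) M k L), ∀ b j, ‖((𝔇 k).𝒦 Z t).Γ₀ b j‖ ≤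
      KΓ * Real.exp (-(kap * tdist1 (𝔇 k).Nf (((𝔇 k).𝒦 Z t).locΛ b) (((𝔇 k).𝒦 Z t).locN j))))
  (hCs : ∀ (k : ℕ) (Z : (domSys (F.P K) M (k + 1)).Dom), ∀ φ ∈ big (k + 1) Z, ∀ t ∈ terms L M Z,
    ∀ σ : TPt (F.P K).d (domCount (F.P K) M (k + 1)) → ℂ, (∀ j, σ j ∈ Uσ) → ∀ b b', ‖((𝔇 k).A Z t φ σ)⁻¹ b b'‖ ≤
      KCs * Real.exp (-(kap * tdist1 (𝔇 k).Nf (((𝔇 k).𝒦 Z t).locΛ b) (((𝔇 k).𝒦 Z t).locΛ b'))))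
  (hC216 : ∀ (k : ℕ) (Z : (domSys (F.P K) M (k + 1)).Dom) (t : TermLabel (F.P K) M k L), ∀ b b', ‖((𝔇 k).𝒦 Z t).C b b'‖ ≤
      KC * Real.exp (-(kap * tdist1 (𝔇 k).Nf (((𝔇 k).𝒦 Z t).locΛ b) (((𝔇 k).𝒦 Z t).locΛ b'))))
  (hdΓ : ∀ (k : ℕ) (Z : (domSys (F.P K) M (k + 1)).Dom), ∀ φ ∈ big (k + 1) Z, ∀ t ∈ terms L M Z,
    ∀ σ : TPt (F.P K).d (domCount (F.P K) M (k + 1)) → ℂ, (∀ j, σ j ∈ Uσ) →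
      ∀ b j, ‖(((𝔇 k).𝒦 Z t).G2 σ ((𝔇 k).uOf Z t φ) - ((𝔇 k).𝒦 Z t).Γ₀.map (algebraMap ℝ ℂ)) b j‖ ≤
        θΓ * Real.exp (-(kap * tdist1 (𝔇 k).Nf (((𝔇 k).𝒦 Z t).locΛ b) (((𝔇 k).𝒦 Z t).locN j))))
  (hdC : ∀ (k : ℕ) (Z : (domSys (F.P K) M (k + 1)).Dom), ∀ φ ∈ big (k + 1) Z, ∀ t ∈ terms L M Z,
    ∀ σ : TPt (F.P K).d (domCount (F.P K) M (k + 1)) → ℂ, (∀ j, σ j ∈ Uσ) →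
      ∀ b b', ‖(((𝔇 k).A Z t φ σ)⁻¹ - ((𝔇 k).𝒦 Z t).C.map (algebraMap ℝ ℂ)) b b'‖ ≤
        θC * Real.exp (-(kap * tdist1 (𝔇 k).Nf (((𝔇 k).𝒦 Z t).locΛ b) (((𝔇 k).𝒦 Z t).locΛ b'))))
  (hdE : ∀ (k : ℕ) (Z : (domSys (F.P K) M (k + 1)).Dom), ∀ φ ∈ big (k + 1) Z, ∀ t ∈ terms L M Z,
    ∀ σ : TPt (F.P K).d (domCount (F.P K) M (k + 1)) → ℂ, (∀ j, σ j ∈ Uσ) →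
      ∀ b b', ‖((𝔇 k).A Z t φ σ - ((𝔇 k).𝒦 Z t).C⁻¹.map (algebraMap ℝ ℂ)) b b'‖ ≤
        θE * Real.exp (-(kap * tdist1 (𝔇 k).Nf (((𝔇 k).𝒦 Z t).locΛ b) (((𝔇 k).𝒦 Z t).locΛ b'))))
  (hsmallKθ : ∀ (k : ℕ) (Z : (domSys (F.P K) M (k + 1)).Dom) (t : TermLabel (F.P K) M k L),
    KC * ((((𝔇 k).𝒦 Z t).m : ℝ) * (1 + 2 / kap) ^ (𝔇 k).ν) * (θ * ((((𝔇 k).𝒦 Z t).m : ℝ) * (1 + 2 / kap'') ^ (𝔇 k).ν)) < 1)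
  -- the (2.24)–(2.25) smallness per term, uniform constants
  {cE gq : ℝ} (hc0 : 0 ≤ cE)
  (hc : ∀ (k : ℕ) (Z : (domSys (F.P K) M (k + 1)).Dom) (t : TermLabel (F.P K) M k L) (i : ((𝔇 k).𝒦 Z t).Λ),
    ((𝔇 k).𝒦 Z t).hC.1.eigenvalues i ≤ cE)
  (hαc : ∀ (k : ℕ) (Z : (domSys (F.P K) M (k + 1)).Dom) (t : TermLabel (F.P K) M k L),
    (2 * (θ * ((((𝔇 k).𝒦 Z t).m : ℝ) * (1 + 2 / kap'') ^ (𝔇 k).ν)) + (γ₂ + a₂₀)) * cE ≤ 1 / 2)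
  (hg : 0 ≤ gq)
  (hΓq : ∀ (k : ℕ) (Z : (domSys (F.P K) M (k + 1)).Dom) (t : TermLabel (F.P K) M k L) (X : ((𝔇 k).𝒦 Z t).Λ ⊕ ((𝔇 k).𝒦 Z t).C₀ → ℝ),
    (((𝔇 k).𝒦 Z t).Γ₀ *ᵥ X) ⬝ᵥ (((𝔇 k).𝒦 Z t).C *ᵥ (((𝔇 k).𝒦 Z t).Γ₀ *ᵥ X)) ≤ gq * (X ⬝ᵥ X))
  (hsm25 : ∀ (k : ℕ) (Z : (domSys (F.P K) M (k + 1)).Dom) (t : TermLabel (F.P K) M k L),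
    (2 * (θ * ((((𝔇 k).𝒦 Z t).m : ℝ) * (1 + 2 / kap'') ^ (𝔇 k).ν)) + (γ₂ + a₂₀)) * (1 + 2 * cE * gq) ≤ 1 / 2)
  -- constant matching, [II] p. 17: the |P|-rate of the weights and «exp O(1)α₅|Z|»
  {a a₅ : ℝ} (hPa : a ≤ γ₂ * rP ^ 2)
  (hvol : ∀ (k : ℕ) (Z : (domSys (F.P K) M (k + 1)).Dom) (t : TermLabel (F.P K) M k L),
    2 * (KC * ((((𝔇 k).𝒦 Z t).m : ℝ) * (1 + 2 / kap) ^ (𝔇 k).ν) * (θ * ((((𝔇 k).𝒦 Z t).m : ℝ) * (1 + 2 / kap'') ^ (𝔇 k).ν))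
            * (1 + (1 - KC * ((((𝔇 k).𝒦 Z t).m : ℝ) * (1 + 2 / kap) ^ (𝔇 k).ν)
              * (θ * ((((𝔇 k).𝒦 Z t).m : ℝ) * (1 + 2 / kap'') ^ (𝔇 k).ν)))⁻¹) / 2)
        * (Fintype.card ((𝔇 k).𝒦 Z t).Λ : ℝ)
      + w + (2 * (θ * ((((𝔇 k).𝒦 Z t).m : ℝ) * (1 + 2 / kap'') ^ (𝔇 k).ν)) + (γ₂ + a₂₀)) * cE * (Fintype.card ((𝔇 k).𝒦 Z t).Λ : ℝ)
      + (2 * (θ * ((((𝔇 k).𝒦 Z t).m : ℝ) * (1 + 2 / kap'') ^ (𝔇 k).ν)) + (γ₂ + a₂₀)) * (1 + 2 * cE * gq)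
        * (Fintype.card (((𝔇 k).𝒦 Z t).Λ ⊕ ((𝔇 k).𝒦 Z t).C₀) : ℝ)
      ≤ a₅ * ((Z.1).card : ℝ))

include hbigo hκ₁ hα₆ hpos hhalf hUσ hUτ hUexp hUtau hr hr' hsubτ hχ0 hχc0 hχm hχcm hAhol hGhol hAholφ hGholφ hVholφ hVm hAs hA hγ₂ ha0 hqP h222 h220U
  hfibN hkap'' h1 h2 hθE hθΓ hθC hKG hKΓ hKCs hKC hθEle hθΓle hθR1le hG hΓ₀ hCs hC216 hdΓ hdC hdE hsmallKθ hc0 hc hαc hg hΓq hsm25 hPa hvol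

/-- **(T-an) ∧ (T-226) FOR `𝔇.TF` ALONG THE HISTORY ON THE OPEN LOCATED-INPUTS TABLES** (§1 at `V := big (k+1) Z`): for every step `k`, every coupling
`g ∈ D`, every older-term table in the class «(1.18)`(E₀,r₁)` on the tables `sp j` + analytic there» (the guard of LEMMA 2's inputs), every `Z ∈ 𝐃_{k+1}`
and every term `(𝐃,P) ∈ terms L M Z`: `φ ↦ 𝔇.TF k Z (𝐃,P) g old φ` is `DifferentiableOn ℂ` on `big (k+1) Z`, and (2.26) holds at every `φ ∈ big (k+1) Z`.
[cite: Balaban1988RG2Cluster, (2.14) p.15 and the analyticity statement p.15, (2.26) p.17, (2.16)-(2.22) p.16, (1.41) p.11] -/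
theorem holAnd226_TF_of_primitives_param :
    ∀ k : ℕ, ∀ s ∈ D, ∀ old : OlderTerms (F.P K) 𝔸 M k,
      (∀ (j : Fin (k + 1)) (Y : (domSys (F.P K) M j).Dom), ∀ ψ ∈ sp j Y,
          ‖old j Y ψ‖ ≤ E₀ * Real.exp (-(r₁ * (domSys (F.P K) M j).dj Y))) →
      (∀ (j : Fin (k + 1)) (Y : (domSys (F.P K) M j).Dom), AnalyticOnNhd ℂ (old j Y) (sp j Y)) →
      ∀ (Z : (domSys (F.P K) M (k + 1)).Dom), ∀ t ∈ terms L M Z,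
        DifferentiableOn ℂ (fun φ => 𝔇.TF k Z t s old φ) (big (k + 1) Z) ∧
          ∀ φ ∈ big (k + 1) Z, ‖𝔇.TF k Z t s old φ‖ ≤ weight L M c Z a t * Real.exp (a₅ * ((Z.1).card : ℝ)) := by
  intro k s hs old hB hAn Z t ht
  rw [TermData214.TF_apply]
  exact differentiableOn_and_norm_TF_of_primitives_param (𝔇 k) hκ₁ hα₆ Z t s old (hbigo k Z) (hpos k) (hhalf k) hUσ (hUτ k) hUexp (hUtau k)
    (hr k) (hr' k) (hsubτ k) (hχ0 k Z t s hs) (hχc0 k Z t s hs) (hχm k Z t s hs) (hχcm k Z t s hs) (fun φ hφ => hAhol k Z φ hφ t ht)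
    (fun φ hφ => hGhol k Z φ hφ t ht) (hAholφ k Z t ht) (hGholφ k Z t ht) (hVholφ k s hs old hB hAn Z t ht)
    (fun φ hφ => hVm k s hs old hB hAn Z φ hφ t ht) (fun φ hφ => hAs k Z φ hφ t ht) (fun φ hφ => hA k Z φ hφ t ht) (qP k Z t)
    (h222 k Z t s hs) hγ₂ (hqP k Z t) ha0 (fun φ hφ => h220U k s hs old hB hAn Z φ hφ t ht) (hfibN k Z t) hkap'' h1 h2 hθE hθΓ hθC hKG hKΓ hKCs
    hKC hθEle hθΓle (hθR1le k Z t) (fun φ hφ => hG k Z φ hφ t ht) (hΓ₀ k Z t) (fun φ hφ => hCs k Z φ hφ t ht) (hC216 k Z t)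
    (fun φ hφ => hdΓ k Z φ hφ t ht) (fun φ hφ => hdC k Z φ hφ t ht) (fun φ hφ => hdE k Z φ hφ t ht) (hsmallKθ k Z t) hc0 (hc k Z t) (hαc k Z t)
    hg (hΓq k Z t) (hsm25 k Z t) hPa (hvol k Z t)

/-- **★★ (T-an) FOR `𝔇.TF` ALONG THE HISTORY — file 23's `hTan` BINDER, PROVED** on every table family `sp₁` inside the open located-inputs tables
(`sp₁ (k+1) Z ⊆ big (k+1) Z`; file 23: `sp₁ := sp`, file 24's pair: `sp₁ := sp′`): for every step, coupling `g ∈ D`, older-term table in the guard class,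
`Z` and term, `φ ↦ 𝔇.TF k Z (𝐃,P) g old φ` is ANALYTIC at the points of `sp₁ (k+1) Z` — print's «analytic function of (𝐔, 𝐉)» ([II] p. 15) as a theorem
(holomorphy under the integral at the corner values + [Chae1985] Thm 14.13). [cite: Balaban1988RG2Cluster, (2.14) p.15 and the analyticity statement p.15; Chae1985, Thm 14.13] -/
theorem termwiseAn_TF_of_primitives_param (sp₁ : (j : ℕ) → (domSys (F.P K) M j).Dom → Set (CPair (F.P K) 𝔸))
    (hsub : ∀ (k : ℕ) (Z : (domSys (F.P K) M (k + 1)).Dom), sp₁ (k + 1) Z ⊆ big (k + 1) Z) :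
    ∀ k : ℕ, ∀ s ∈ D, ∀ old : OlderTerms (F.P K) 𝔸 M k,
      (∀ (j : Fin (k + 1)) (Y : (domSys (F.P K) M j).Dom), ∀ ψ ∈ sp j Y,
          ‖old j Y ψ‖ ≤ E₀ * Real.exp (-(r₁ * (domSys (F.P K) M j).dj Y))) →
      (∀ (j : Fin (k + 1)) (Y : (domSys (F.P K) M j).Dom), AnalyticOnNhd ℂ (old j Y) (sp j Y)) →
      ∀ (Z : (domSys (F.P K) M (k + 1)).Dom), ∀ t ∈ terms L M Z, AnalyticOnNhd ℂ (fun φ => (𝔇 k).TF Z t s old φ) (sp₁ (k + 1) Z) := by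
  intro k s hs old hB hAn Z t ht
  have h := (holAnd226_TF_of_primitives_param F K L 𝔇 D sp big hbigo hκ₁ hα₆ hpos hhalf hUσ hUτ hUexp hUtau hr hr' hsubτ hχ0 hχc0 hχm hχcm hAhol
    hGhol hAholφ hGholφ hVholφ hVm hAs hA hγ₂ ha0 qP hqP h222 h220U hfibN hkap'' h1 h2 hθE hθΓ hθC hKG hKΓ hKCs hKC hθEle hθΓle hθR1le hG hΓ₀ hCs
    hC216 hdΓ hdC hdE hsmallKθ hc0 hc hαc hg hΓq hsm25 hPa hvol k s hs old hB hAn Z t ht).1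
  rw [TermData214.TF_apply] at h
  exact (analyticOnNhd_of_differentiableOn h (hbigo k Z)).mono (hsub k Z)

end Located

end Summit.QuantumFields.YangMills.BalabanUVNodes.N18HLayerW1TermAnalytic

end
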